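import Summits.HodgeConjecture.HodgeConjecture.Theses.LinearSystemTorelli
import Literature.AlgebraicGeometry.HodgeTheory.SupportedHodgeClassDescent
import Literature.AlgebraicGeometry.Resolution.ProjectiveResolutionProofs
import Literature.AlgebraicGeometry.HodgeTheory.GysinKernelProofs
import Literature.AlgebraicTopology.SingularHomology.GysinTransposition

/-!
# Crux `TranscendentalOrSupported` (stmt-HodgeConjecture-10853), line `Sketch` — REMARKS (lead):
# the bet `InvisiblePerp` FOLLOWS from the crux, granted Deligne's Cor. 8.2.8

Companion of `Lines/Sketch.lean` (kept out of the skeleton so that `TranscendentalOrSupported_of` is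
its only theorem concluding the crux). The skeleton proves the crux from the bet `stub_invisiblePerp`
(invisible classes are cup-orthogonal to the Hodge-theoretic span) by Poincaré duality; here the
CONVERSE: the crux implies the bet — for every `p ≥ 1` — granted the tree's named fact
`Deligne1974_ker_restrictCompl_eq_iSup_range_complexGysin` (Hodge III Cor. 8.2.8: a class dying off
`Z = ⋃ⱼ gⱼ(Yⱼ)` is a sum of Gysin images from the `Yⱼ`). So the line is a FAITHFUL dual
reformulation of GHC(2p, 1): its bet is neither weaker nor (modulo 8.2.8) stronger than the crux.

Proof: `b j ∈ N¹ H²ᵖ` dies off one closed `Z` of codimension `≥ 1`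
(`exists_isClosed_of_mem_supportedClasses`); `Z = ⋃ⱼ gⱼ(Yⱼ)` for finitely many `gⱼ : Yⱼ ⟶ X` from
smooth projective varieties of dimension `< 2p` (`exists_family_iUnion_range_eq`: the components resolved
by Hironaka, `Resolution.Hironaka1964_projective_holds`, proved); by 8.2.8 `b j = Σ (gⱼ)_* yⱼ`; and
`⟨g_* y ⌣ c, [X]⟩ = ⟨y ⌣ g^* c, [Y]⟩ = 0` for an invisible `c` (`cupPairing_gysinMap`).
-/

noncomputable section

set_option linter.dupNamespace false

open CategoryTheory
open Literature.AlgebraicGeometry.Motives Literature.AlgebraicGeometry.HodgeTheory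
open Literature.AlgebraicTopology.SingularHomology

namespace Summit.HodgeConjecture.HodgeConjecture.Cruxes.TranscendentalOrSupported.CurveSweep

/-- **Gysin images are cup-orthogonal to invisible classes**: for `g : Y ⟶ X` from a smooth projective
`Y` of dimension `m` to the `2p`-fold `X`, `y ∈ Hᵃ(Y(ℂ); ℂ)` (`a + 4p = 2p + 2m`) and `c ∈ H²ᵖ(X(ℂ); ℂ)`
with `g^* c = 0`: `⟨g_* y ⌣ c, [X(ℂ)]⟩ = ⟨y ⌣ g^* c, [Y(ℂ)]⟩ = 0` (transposition
`cupPairing_gysinMap`; in degrees `a > 2m` the Gysin morphism is `0`). -/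
theorem cupPairing_complexGysin_eq_zero_of_map_eq_zero (μ : OrientationFamily) {p : ℕ}
    {X : SchemeOver ℂ} (hX : IsSmoothProjective (2 * p) X) {m : ℕ} {Y : SchemeOver ℂ}
    (hY : IsSmoothProjective m Y) (g : Y ⟶ X) {a : ℕ} (hab : a + 2 * (2 * p) = 2 * p + 2 * m)
    (y : complexBetti Y a) {c : complexBetti X (2 * p)} (hc : complexBetti.map g (2 * p) c = 0) :
    cupPairing (μ hX) (two_mul (2 * p)).symm (complexGysin μ hY hX g hab y) c = 0 := by
  by_cases ha : a ≤ 2 * m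
  · rw [complexGysin_eq_gysinMap hY hX g hab (q := 2 * p) (by omega) (two_mul (2 * p)).symm,
      cupPairing_gysinMap (μ.hasPoincareDuality hX)]
    change cupPairing (μ hY) _ y (complexBetti.map g (2 * p) c) = 0
    rw [hc, map_zero]
  · rw [complexGysin_of_lt hY hX g hab (by omega), LinearMap.zero_apply, map_zero,
      LinearMap.zero_apply]

/-- **The crux implies the bet `InvisiblePerp`, for every `p ≥ 1`, granted Deligne's Cor. 8.2.8**
(`Deligne1974_ker_restrictCompl_eq_iSup_range_complexGysin`): under the crux, `b j ∈ N¹ H²ᵖ` dies off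
a closed `Z` of codimension `≥ 1`, which is `⋃ⱼ gⱼ(Yⱼ)` for finitely many morphisms from smooth
projective varieties of dimension `< 2p`; by 8.2.8 `b j` is a sum of Gysin
images `(gⱼ)_* yⱼ` (`exists_family_iUnion_range_eq` with `Resolution.Hironaka1964_projective_holds`),
each cup-orthogonal to an invisible `c` (`cupPairing_complexGysin_eq_zero_of_map_eq_zero`). -/
theorem invisiblePerp_of_transcendentalOrSupported
    (hA : Deligne1974_ker_restrictCompl_eq_iSup_range_complexGysin)
    (hT : Summit.HodgeConjecture.HodgeConjecture.Theses.LinearSystemTorelli.TranscendentalOrSupported) :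
    ∀ ⦃p : ℕ⦄ ⦃X : SchemeOver ℂ⦄, 1 ≤ p → ∀ (hX : IsSmoothProjective (2 * p) X)
    (A : HodgeModel (2 * p) X) (r : ℕ) (b : Fin r → complexBetti X (2 * p)),
    (∀ j, IsRationalClass (b j)) →
    (Submodule.span ℂ (Set.range b)).map (A.pullback (2 * p)).hom =
      ⨆ (p' : ℕ) (q' : ℕ) (_ : p' + q' = 2 * p),
        (Submodule.span ℂ (Set.range b)).map (A.pullback (2 * p)).hom ⊓ A.hodgePQ (2 * p) p' q' →
    (Submodule.span ℂ (Set.range b)).map (A.pullback (2 * p)).hom ⊓ A.hodgePQ (2 * p) (2 * p) 0 = ⊥ →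
    ∀ (μ : OrientationFamily) (j : Fin r) (c : complexBetti X (2 * p)),
      (∀ (m : ℕ) (Y : SchemeOver ℂ), IsSmoothProjective m Y → m < 2 * p → ∀ g : Y ⟶ X,
        complexBetti.map g (2 * p) c = 0) →
      cupPairing (μ hX) (two_mul (2 * p)).symm (b j) c = 0 := by
  intro p X hp hX A r b hb hsub hbot μ j c hc
  have hmem : b j ∈ supportedClasses X (2 * p) 1 := hT hp hX A r b hb hsub hbot j
  -- `b j` dies off one closed `Z` of codimension `≥ 1`
  obtain ⟨Z, hZ, hZ1, hbZ⟩ := exists_isClosed_of_mem_supportedClasses hmem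
  -- `Z = ⋃ⱼ gⱼ(Yⱼ)` with `Yⱼ` smooth projective of dimensions `m j < 2p`
  obtain ⟨ι, hι, m, Y, hY, g, hm, hZg⟩ :=
    exists_family_iUnion_range_eq Literature.AlgebraicGeometry.Resolution.Hironaka1964_projective_holds
      hX hZ hZ1
  haveI := hι
  -- Deligne's Cor. 8.2.8: `b j` is a sum of Gysin images from the `Yⱼ`
  have hker : b j ∈ LinearMap.ker
      (complexBetti.restrictCompl X (⋃ i, Set.range (g i).left.base) (2 * p)).hom := by
    rw [LinearMap.mem_ker, hZg]
    exact hbZ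
  rw [hA μ μ.hasPoincareDuality hX hY g (2 * p)] at hker
  -- every Gysin image pairs to zero with the invisible `c`
  have hle : (⨆ (i : ι) (a : ℕ) (hab : a + 2 * (2 * p) = 2 * p + 2 * m i),
      LinearMap.range (complexGysin μ (hY i) hX (g i) hab)) ≤
      LinearMap.ker ((cupPairing (μ hX) (two_mul (2 * p)).symm).flip c) := by
    refine iSup_le fun i ↦ iSup_le fun a ↦ iSup_le fun hab ↦ ?_
    rintro _ ⟨y, rfl⟩
    rw [LinearMap.mem_ker, LinearMap.flip_apply]
    exact cupPairing_complexGysin_eq_zero_of_map_eq_zero μ hX (hY i) (g i) hab y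
      (hc (m i) (Y i) (hY i) (hm i) (g i))
  have := hle hker
  rwa [LinearMap.mem_ker, LinearMap.flip_apply] at this

end Summit.HodgeConjecture.HodgeConjecture.Cruxes.TranscendentalOrSupported.CurveSweep

end
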